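import Summits.BirchSwinnertonDyer.BirchSwinnertonDyer.Theorems.GenusKolyvaginAtTwoShaCardDvdPowAtTwoRTRankQ
import Summits.BirchSwinnertonDyer.BirchSwinnertonDyer.Theorems.GenusKolyvaginAtTwoGenusPrimitiveSupplyAtTwoTwistMasterFrame
import Summits.BirchSwinnertonDyer.BirchSwinnertonDyer.Theorems.GenusKolyvaginAtTwoGenusPrimitiveSupplyAtTwoSelmerTransferDown
import Summits.BirchSwinnertonDyer.BirchSwinnertonDyer.Theorems.GenusKolyvaginAtTwoGenusPrimitiveSupplyAtTwoTwistSelmerStrictInherit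
import HarnessLib

/-!
# Route `GenusKolyvaginAtTwo`, crux 23491 (Δ<0 supply), `#Sel₂(E) = 4` cell: THE TWIN IS STRICT AT THE TWISTING PRIME —
# the LEAD's instrument I2 («`#Sel₂(E) = 4` ⟹ the twin's point is NON-singular at `ℓ₀`») as an UNCONDITIONAL Selmer theorem

Seat `bsd-line-gk2-p5` g34 (cell `bsd-f1-sign2`, WIDTH-5 attach), `--supports stmt-BirchSwinnertonDyer-23491 --as helper`.  THEOREMS ONLY (no
definition, no named fact, no `sorry`); UNCONDITIONAL (Poitou–Tate and Tate's local Euler characteristic are tree theorems).  **BSD is NOT proved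
by this file and no item is closed by it.**

LEAD memo `DEPTH-ZERO-REDUCTION-CRITERION-g21.md` §3, prediction I2: on the `#Sel₂(E) = 4` cell (Δ<0, prime Heegner field with DEF-1 prime `ℓ₀`,
`2`-Selmer-minimal twin `Wd`) the twin's Heegner point is locally `2`-divisible at `ℓ₀` («non-singular reduction»), stated as a THEOREM modulo Q2 +
PAIRCOUNT.  Its SELMER half is unconditional and needs neither: Mazur–Rubin Cor. 3.4 (i), NON-STRICT direction, run for the pair `(Wd, W)` —
if some class of `Sel₂(Wd)` were non-strict at `ℓ₀`, then `#Sel₂(W)·2 = #Sel₂(Wd)`, i.e. `8 = 2`.  Companion of `TwinStrict.not_twin_le_strictLocalKer_…`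
(p763895: on `#Sel₂(E) = 1` the twin is NOT strict) — together: **on the Δ<0 narrow cells the twin's strictness at `ℓ₀` READS `#Sel₂(E)`**.
With gk2-p4 g25's local Kummer reading (p764224/p763963: strict at `ℓ₀` ⟺ `2`-divisible in `Wd(ℚ_{ℓ₀})`) this is I2 on points.

* §1 `natCard_selmerGroup_mul_two_eq_of_twin_localization_ne_zero` — `W/ℚ` globally minimal, `Δ_W < 0`, `K` imaginary quadratic with odd `d_K`,
  Heegner for `N_W`, `2` split; `ℓ₀ ∣ d_K` with `#W(ℚ_{ℓ₀})[2] = 2`, every other prime of `d_K` silent; `Wd = Cd • W^(d_K)`: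
  a class of `Sel₂(Wd)` with `loc_{ℓ₀} ≠ 0` forces `#Sel₂(W)·2 = #Sel₂(Wd)`.  The master datum `φ : Wd[2] ⇄ W[2] : φ'` of gk2-p4's
  `exists_intertwining_master_frame` is used BACKWARDS (base `Wd`, partner `W`): split agreement and Lemma 2.11 transversality at `ℓ₀` are
  transported along `φ'` (`H¹(φ'_v) ∘ H¹(φ_v) = id`), good–good and silent–silent rows are symmetric; then gk2-p4's non-strict engine
  `natCard_selmerGroup_mul_eq_of_transverse_of_localization_ne_zero` (no parity input, no good reduction of the base at `ℓ₀` needed).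
* §2 **`twin_le_strictLocalKer_of_natCard_selmerGroup_eq_four`** (`#Sel₂(W) = 4`, `#Sel₂(Wd) = 2` ⟹ `Sel₂(Wd) ≤ strictLocalKer Wd ℚ_{ℓ₀} 2`) and
  `forall_twin_selmer_localization_eq_zero_of_natCard_selmerGroup_eq_four` (every class of `Sel₂(Wd)` has `loc_v = 0` at the place `v ∋ ℓ₀`).

References: [MazurRubin2010] Remark 2.4, Lemmas 2.9–2.11, Prop. 3.3, Cor. 3.4 (i); [Kramer1981] §2 Props. 1–3, Thm. 1; [MilneADT2006] I Thm. 2.8,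
I Thm. 4.10; [GrossLMS1991] §1 (p. 235).
-/

set_option linter.dupNamespace false -- `Summit.<P>.<Sub>` repeats `BirchSwinnertonDyer` (D-0017)
set_option autoImplicit false

noncomputable section

open scoped Classical ContRepresentation

namespace Summit.BirchSwinnertonDyer.BirchSwinnertonDyer.Theorems.GenusSupplyNarrow.TwinStrict

open WeierstrassCurve Field NumberField IsDedekindDomain Function
open Literature.NumberTheory.EllipticCurves Literature.NumberTheory.GaloisRepresentations
open Literature.NumberTheory.GaloisRepresentations.IsNonarchimedeanLocalField (maxUnramified)
open Literature.NumberTheory.GaloisRepresentations.DiscreteGaloisModule (SelmerStructure)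
open Literature.NumberTheory.GaloisCohomology
open Literature.NumberTheory.QuadraticFields
open Summit.BirchSwinnertonDyer.Rank1Residual.X11b
open Summit.BirchSwinnertonDyer.Rank1Residual.X11b.CongruentTransfer
open Summit.BirchSwinnertonDyer.BirchSwinnertonDyer.Theorems.GenusKolyTwistLocal
open Summit.BirchSwinnertonDyer.BirchSwinnertonDyer.Theorems.GenusExact.PlusDescent
open Summit.BirchSwinnertonDyer.BirchSwinnertonDyer.Theorems.SchneiderFreeAdditiveX3.PoitouTateReduction
  (poitouTate_selmerStructure_duality_real_holds)
open Rat.HeightOneSpectrum (primesEquiv natGenerator)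

variable (W : WeierstrassCurve ℚ) [W.IsElliptic] [W.IsGloballyMinimal]

/-! ## §1 A non-strict class of the TWIN at the twisting prime halves `#Sel₂` downwards: `#Sel₂(W)·2 = #Sel₂(Wd)` -/

/-- **Mazur–Rubin Cor. 3.4 (i), NON-STRICT direction, for the pair `(Wd, W)` at the twisting prime — UNCONDITIONAL.**  `W/ℚ` globally minimal
elliptic with `Δ_W < 0`; `K` imaginary quadratic with odd `d_K`, Heegner for `N_W`, `2` split in `K`; `ℓ₀ ∣ d_K` a prime with `#W(ℚ_{ℓ₀})[2] = 2`,
every other prime of `d_K` silent (`W(ℚ_p)[2] = 0`); `Wd = Cd • W^(d_K)` elliptic.  IF some class of `Sel₂(Wd)` has non-zero localisation at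
the place over `ℓ₀`, THEN `#Sel₂(W)·2 = #Sel₂(Wd)`.  [cite: MazurRubin2010, Prop. 3.3, Cor. 3.4 (i), Lemma 2.11 (arXiv:0904.3709 pp. 8–10)]
[cite: MilneADT2006, I Thm. 2.8 and Thm. 4.10] -/
theorem natCard_selmerGroup_mul_two_eq_of_twin_localization_ne_zero {K : Type} [Field K] [NumberField K]
    (hΔ : W.Δ < 0) (hK : IsImaginaryQuadratic K) (hodd : Odd (discr K)) (hH : SatisfiesHeegnerHypothesis (W.conductorNorm ℤ) K)
    (h2K : ((Ideal.span {(2 : ℤ)}).primesOver (𝓞 K)).ncard = 2)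
    {ℓ₀ : ℕ} [Fact ℓ₀.Prime] (hℓd : (ℓ₀ : ℤ) ∣ discr K)
    (hq2 : Nat.card {Q : (W.baseChange ℚ_[ℓ₀]).toAffine.Point // 2 • Q = 0} = 2)
    (hT : ∀ (p : ℕ) [Fact p.Prime], (p : ℤ) ∣ discr K → p ≠ ℓ₀ → ∀ Q : (W.baseChange ℚ_[p]).toAffine.Point, 2 • Q = 0 → Q = 0)
    {Wd : WeierstrassCurve ℚ} [Wd.IsElliptic] (Cd : VariableChange ℚ) (hCd : Cd • W.quadraticTwist (discr K : ℚ) = Wd)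
    {v₀ : HeightOneSpectrum (𝓞 ℚ)} (hv₀ : (ℓ₀ : 𝓞 ℚ) ∈ v₀.asIdeal)
    (hns : ∃ c ∈ (Wd.kummerSelmerStructure ((2 : ℕ) : ℤ)).selmerGroup,
      galoisCohomology.localization (Wd.torsionGaloisModule ((2 : ℕ) : ℤ)) (Sum.inr v₀) 1 c ≠ 0) :
    Nat.card (W.selmerGroup ((2 : ℕ) : ℤ)) * 2 = Nat.card (Wd.selmerGroup ((2 : ℕ) : ℤ)) := by
  haveI : Fact (Nat.Prime 2) := ⟨Nat.prime_two⟩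
  have hℓ : ℓ₀.Prime := Fact.out
  have hℓ2 : ℓ₀ ≠ 2 := by
    rintro rfl
    exact (Int.not_even_iff_odd.mpr hodd) (even_iff_two_dvd.mpr (by exact_mod_cast hℓd))
  have hℓN : ¬ ℓ₀ ∣ W.conductorNorm ℤ := fun h ↦ Literature.SatisfiesHeegnerHypothesis.not_dvd_discr hK.1 hH hℓ h hℓd
  have hv₀ℓ : ((primesEquiv v₀ : Nat.Primes) : ℕ) = ℓ₀ := primesEquiv_eq_of_natCast_mem hℓ hv₀
  have hd0 : (discr K : ℚ) ≠ 0 := by exact_mod_cast NumberField.discr_ne_zero K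
  -- `W` good at `v₀`, `v₀ ∤ 2`, `√d_K` ramified at `v₀`
  have hW : W.HasGoodReductionAt v₀ := by
    by_contra h
    exact hℓN (hv₀ℓ ▸ (W.dvd_conductorNorm_iff v₀).mpr h)
  have h2v₀ : ((2 : ℕ) : 𝓞 ℚ) ∉ v₀.asIdeal :=
    GenusKolyTwistingPrime.natCast_not_mem_of_not_dvd hℓ hv₀ fun h ↦ hℓ2 ((Nat.prime_dvd_prime_iff_eq hℓ Nat.prime_two).mp h)
  have hram : closureEmb (K := ℚ) (v₀.adicCompletion ℚ) (geomSqrt (discr K : ℚ)) ∉ maxUnramified (v₀.adicCompletion ℚ) :=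
    GenusKolyTwistRamified.closureEmb_geomSqrt_not_mem_maxUnramified_rat v₀
      (valuation_discr_eq_exp_neg_one_of_dvd hK.1 hodd v₀ hℓ hv₀ hℓd)
  -- Poitou–Tate and Tate's local Euler characteristic (tree theorems)
  have hPT := poitouTate_selmerStructure_duality_real_holds (K := ℚ)
  have hEP : ∀ v : HeightOneSpectrum (𝓞 ℚ), localEulerPoincareCharacteristic (v.adicCompletion ℚ) := fun v ↦
    haveI : CharZero (v.adicCompletion ℚ) := charZero_of_injective_algebraMap (algebraMap ℚ _).injective
    localEulerPoincareCharacteristic_holds (v.adicCompletion ℚ)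
  -- the master datum for `(W, Wd)`, used backwards
  obtain ⟨φ, ψ, hψφ, hφψ, hsplit, -, htr, -, -⟩ := exists_intertwining_master_frame W Wd hd0 hCd
  -- `H¹(ψ_v) ∘ H¹(φ_v) = id`, so `ψ`-transport undoes `φ`-transport
  have hundo : ∀ (v : Place ℚ) (X : AddSubgroup (galoisCohomology ((Wd.torsionGaloisModule ((2 : ℕ) : ℤ)).toLocal v) 1)),
      (X.map (galoisCohomology.map (φ.restrictField (Place.Completion v)) 1)).map
        (galoisCohomology.map (ψ.restrictField (Place.Completion v)) 1) = X := by
    intro v X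
    rw [AddSubgroup.map_map]
    conv_rhs => rw [← AddSubgroup.map_id X]
    congr 1
    ext x
    exact map_restrictField_map_restrictField_of_comp_eq φ ψ hψφ v x
  -- the transported Kummer structure of `W` on `Wd[2]`
  let 𝓐 : SelmerStructure (Wd.torsionGaloisModule ((2 : ℕ) : ℤ)) := fun v ↦
    (W.kummerSelmerStructure ((2 : ℕ) : ℤ) v).map (galoisCohomology.map (ψ.restrictField (Place.Completion v)) 1)
  have h𝓐 : ∀ v, 𝓐 v = (W.kummerSelmerStructure ((2 : ℕ) : ℤ) v).map
      (galoisCohomology.map (ψ.restrictField (Place.Completion v)) 1) := fun _ ↦ rfl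
  -- split places: `ψ_* 𝓛(W) = 𝓛(Wd)`
  have hsplit' : ∀ v : Place ℚ, (∃ s : Place.Completion v, s ^ 2 = algebraMap ℚ (Place.Completion v) (discr K : ℚ)) →
      𝓐 v = Wd.kummerSelmerStructure ((2 : ℕ) : ℤ) v := by
    intro v hs
    rw [h𝓐, kummerSelmerStructure_apply, kummerSelmerStructure_apply, ← hsplit (Place.Completion v) hs, hundo]
  -- agreement off `v₀`
  have hagree : ∀ v : Place ℚ, v ≠ Sum.inr v₀ → 𝓐 v = Wd.kummerSelmerStructure ((2 : ℕ) : ℤ) v := by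
    rintro (w | v) hv
    · -- the real place: `H¹ = 0` for both (`Δ < 0`)
      rcases twist_place_menu_infinite_rat W hΔ hd0 hCd w with ⟨s, hs⟩ | ⟨hW0, hWd0⟩
      · exact hsplit' (Sum.inl w) ⟨s, hs⟩
      · rw [h𝓐, kummerSelmerStructure_apply, kummerSelmerStructure_apply]
        exact map_kummerLocalConditionAt_eq_of_eq_top Wd W ((2 : ℕ) : ℤ) (Place.Completion (Sum.inl w)) ψ φ hψφ
          (kummerLocalConditionAt_eq_top_of_forall_eq_zero W _ _ hW0)
          (kummerLocalConditionAt_eq_top_of_forall_eq_zero Wd _ _ hWd0)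
    · have hvv₀ : v ≠ v₀ := fun h ↦ hv (by rw [h])
      haveI := Fact.mk (primesEquiv v).2
      set p : ℕ := ((primesEquiv v : Nat.Primes) : ℕ) with hp
      have hpP : p.Prime := (primesEquiv v).2
      have hpv : (p : 𝓞 ℚ) ∈ v.asIdeal := Rat.HeightOneSpectrum.natCast_natGenerator_mem v
      by_cases hspl : p ∣ W.conductorNorm ℤ ∨ p = 2
      · -- split in `K`
        refine hsplit' (Sum.inr v) (exists_sq_eq_discr_adicCompletion_of_ncard_primesOver hK.1 v ?_)
        rcases hspl with hpN | hp2
        · exact hH p hpP hpN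
        · rw [← hp, hp2]; exact h2K
      · rw [not_or] at hspl
        obtain ⟨hpN, hp2⟩ := hspl
        have h2v : ((2 : ℕ) : 𝓞 ℚ) ∉ v.asIdeal :=
          GenusKolyTwistingPrime.natCast_not_mem_of_not_dvd hpP hpv fun h ↦ hp2 ((Nat.prime_dvd_prime_iff_eq hpP Nat.prime_two).mp h)
        have hWv : W.HasGoodReductionAt v := by
          by_contra h
          exact hpN ((W.dvd_conductorNorm_iff v).mpr h)
        by_cases hpd : (p : ℤ) ∣ discr K
        · -- another prime of `d_K`: silent for `W` and for `Wd`
          have hpℓ : p ≠ ℓ₀ := fun h ↦ hvv₀ (primesEquiv.injective (Subtype.ext (h.trans hv₀ℓ.symm)))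
          have hW1 : Nat.card {Q : (W.baseChange ℚ_[p]).toAffine.Point // 2 • Q = 0} = 1 :=
            Nat.card_eq_one_iff_exists.mpr ⟨⟨0, nsmul_zero 2⟩, fun Q ↦ Subtype.ext (hT p hpd hpℓ Q.1 Q.2)⟩
          have h1W : Nat.card (nsmulAddMonoidHom 2 : (W.baseChange (v.adicCompletion ℚ)).toAffine.Point →+ _).ker = 1 := by
            rw [natCard_ker_nsmul_adicCompletion_eq_padic W v 2]; exact hW1
          have h1Wd : Nat.card (nsmulAddMonoidHom 2 : (Wd.baseChange (v.adicCompletion ℚ)).toAffine.Point →+ _).ker = 1 := by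
            rw [natCard_ker_nsmul_adicCompletion_eq_padic Wd v 2, GenusKolyTwistTamagawa.natCard_twoTorsion_padic_twist_eq W hd0 hCd]
            exact hW1
          rw [h𝓐, kummerSelmerStructure_apply, kummerSelmerStructure_apply]
          exact map_kummerLocalConditionAt_adicCompletion_eq_of_natCard_ker_eq_one Wd W v two_ne_zero h2v h1Wd h1W ψ
        · -- odd, good for both
          have hpd' : ¬ ((p : ℕ) : ℤ) ∣ 2 * discr K := by
            intro h
            rcases (Nat.prime_iff_prime_int.mp hpP).dvd_or_dvd h with h2' | hd'
            · exact hp2 ((Nat.prime_dvd_prime_iff_eq hpP Nat.prime_two).mp (by exact_mod_cast h2'))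
            · exact hpd hd'
          exact transport_kummer_inr_eq_of_good Wd W 2 ψ φ hψφ 𝓐 h𝓐 h2v
            (hasGoodReductionAt_of_smul_quadraticTwist W v hpd' hWv hCd) hWv
  -- transversality at `v₀`, transported along `ψ`
  have htr' : 𝓐 (Sum.inr v₀) ⊓ Wd.kummerSelmerStructure ((2 : ℕ) : ℤ) (Sum.inr v₀) = ⊥ := by
    have h0 := htr v₀ hW h2v₀ hram
    rw [h𝓐, kummerSelmerStructure_apply, kummerSelmerStructure_apply, AddSubgroup.eq_bot_iff_forall]
    intro x hx
    obtain ⟨hx𝓐, hxWd⟩ := AddSubgroup.mem_inf.mp hx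
    obtain ⟨y, hy, rfl⟩ := AddSubgroup.mem_map.mp hx𝓐
    -- `φ (ψ y) = y ∈ 𝓛(W)` and `φ (ψ y) ∈ φ_* 𝓛(Wd)`: so `y = 0` by Lemma 2.11 for `(W, Wd)`
    have hφx : galoisCohomology.map (φ.restrictField (Place.Completion (Sum.inr v₀ : Place ℚ))) 1
        (galoisCohomology.map (ψ.restrictField (Place.Completion (Sum.inr v₀ : Place ℚ))) 1 y) = y :=
      map_restrictField_map_restrictField_of_comp_eq ψ φ hφψ (Sum.inr v₀) y
    have hmem : y ∈ (Wd.kummerLocalConditionAt ((2 : ℕ) : ℤ) (v₀.adicCompletion ℚ)).map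
          (galoisCohomology.map (φ.restrictField (v₀.adicCompletion ℚ)) 1) ⊓
        W.kummerLocalConditionAt ((2 : ℕ) : ℤ) (v₀.adicCompletion ℚ) :=
      AddSubgroup.mem_inf.mpr ⟨AddSubgroup.mem_map.mpr ⟨_, hxWd, hφx⟩, hy⟩
    rw [h0] at hmem
    have hy0 : y = 0 := AddSubgroup.mem_bot.mp hmem
    rw [hy0, map_zero]
  -- `t_{v₀}(Wd) = 2`
  have ht' : Nat.card (nsmulAddMonoidHom 2 : (Wd.baseChange (v₀.adicCompletion ℚ)).toAffine.Point →+ _).ker *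
      Nat.card (v₀.adicCompletionIntegers ℚ ⧸ Ideal.span {((2 : ℕ) : v₀.adicCompletionIntegers ℚ)}) = 2 := by
    rw [natCard_quotient_span_natCast_eq_one_of_not_mem v₀ h2v₀, mul_one, natCard_ker_nsmul_adicCompletion_eq_padic Wd v₀ 2,
      GenusKolyTwistTamagawa.natCard_twoTorsion_padic_twist_eq W hd0 hCd]
    subst hv₀ℓ
    exact hq2
  exact natCard_selmerGroup_mul_eq_of_transverse_of_localization_ne_zero Wd W 2 hPT hEP ψ φ hφψ hψφ 𝓐 h𝓐 v₀ hagree htr' ht' hns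

/-! ## §2 On the `#Sel₂(E) = 4` cell the twin IS strict at the twisting prime -/

/-- **I2, SELMER HALF: on the `#Sel₂(E) = 4` cell the `2`-Selmer-minimal twin is STRICT at the twisting prime.**  Frame of §1 with `#Sel₂(W) = 4`
and `#Sel₂(Wd) = 2`: `Sel₂(Wd) ≤ strictLocalKer Wd ℚ_{ℓ₀} 2` (a non-strict class would give `4·2 = 2` by §1).  UNCONDITIONAL.  With gk2-p4
g25's local reading (`exists_two_smul_completion_iff_kummer_eq_zero…`): the twin's generator — the twin Heegner point when it is `2`-primitive
in `Wd(ℚ)` — is `2`-DIVISIBLE in `Wd(ℚ_{ℓ₀})` («reduces to the identity component / non-singular point at `ℓ₀`»): the LEAD's instrument I2 needs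
neither Q2 nor PAIRCOUNT.  Companion of `not_twin_le_strictLocalKer_of_natCard_selmerGroup_eq_one` (p763895, `#Sel₂(E) = 1`: NOT strict).
[cite: MazurRubin2010, Cor. 3.4 (i)] [cite: Kramer1981, §2 Prop. 3] -/
theorem twin_le_strictLocalKer_of_natCard_selmerGroup_eq_four {K : Type} [Field K] [NumberField K]
    (hΔ : W.Δ < 0) (hK : IsImaginaryQuadratic K) (hodd : Odd (discr K)) (hH : SatisfiesHeegnerHypothesis (W.conductorNorm ℤ) K)
    (h2K : ((Ideal.span {(2 : ℤ)}).primesOver (𝓞 K)).ncard = 2)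
    {ℓ₀ : ℕ} [Fact ℓ₀.Prime] (hℓd : (ℓ₀ : ℤ) ∣ discr K)
    (hq2 : Nat.card {Q : (W.baseChange ℚ_[ℓ₀]).toAffine.Point // 2 • Q = 0} = 2)
    (hT : ∀ (p : ℕ) [Fact p.Prime], (p : ℤ) ∣ discr K → p ≠ ℓ₀ → ∀ Q : (W.baseChange ℚ_[p]).toAffine.Point, 2 • Q = 0 → Q = 0)
    (h4 : Nat.card (W.selmerGroup 2) = 4)
    {Wd : WeierstrassCurve ℚ} [Wd.IsElliptic] (Cd : VariableChange ℚ) (hCd : Cd • W.quadraticTwist (discr K : ℚ) = Wd)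
    (hSel : Nat.card (Wd.selmerGroup 2) = 2) :
    Wd.selmerGroup 2 ≤ MazurRubin2010.strictLocalKer Wd ℚ_[ℓ₀] 2 := by
  have hℓ : ℓ₀.Prime := Fact.out
  obtain ⟨v₀, hv₀ℓ⟩ : ∃ v : HeightOneSpectrum (𝓞 ℚ), ((primesEquiv v : Nat.Primes) : ℕ) = ℓ₀ :=
    ⟨primesEquiv.symm ⟨ℓ₀, hℓ⟩, by rw [Equiv.apply_symm_apply]⟩
  have hv₀ : (ℓ₀ : 𝓞 ℚ) ∈ v₀.asIdeal := by
    rw [← hv₀ℓ]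
    exact Rat.HeightOneSpectrum.natCast_natGenerator_mem v₀
  by_contra hns
  have hns' : ∃ c ∈ (Wd.kummerSelmerStructure ((2 : ℕ) : ℤ)).selmerGroup,
      galoisCohomology.localization (Wd.torsionGaloisModule ((2 : ℕ) : ℤ)) (Sum.inr v₀) 1 c ≠ 0 := by
    apply exists_selmer_localization_ne_zero_of_not_le_strictLocalKer Wd v₀
    subst hv₀ℓ
    exact hns
  have h := natCard_selmerGroup_mul_two_eq_of_twin_localization_ne_zero W hΔ hK hodd hH h2K hℓd hq2 hT Cd hCd hv₀ hns'
  simp only [Nat.cast_ofNat] at h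
  rw [h4, hSel] at h
  omega

/-- **Every `2`-Selmer class of the twin localises to `0` at the place over the twisting prime** (same cell; the strictness of
`twin_le_strictLocalKer_of_natCard_selmerGroup_eq_four` in the localisation currency, `forall_selmer_localization_eq_zero_of_le_strictLocalKer`).
[cite: MazurRubin2010, Def. 3.1, Cor. 3.4 (i)] -/
theorem forall_twin_selmer_localization_eq_zero_of_natCard_selmerGroup_eq_four {K : Type} [Field K] [NumberField K]
    (hΔ : W.Δ < 0) (hK : IsImaginaryQuadratic K) (hodd : Odd (discr K)) (hH : SatisfiesHeegnerHypothesis (W.conductorNorm ℤ) K)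
    (h2K : ((Ideal.span {(2 : ℤ)}).primesOver (𝓞 K)).ncard = 2)
    {ℓ₀ : ℕ} (hℓ : ℓ₀.Prime) (hℓd : (ℓ₀ : ℤ) ∣ discr K)
    (hq2 : haveI := Fact.mk hℓ; Nat.card {Q : (W.baseChange ℚ_[ℓ₀]).toAffine.Point // 2 • Q = 0} = 2)
    (hT : ∀ (p : ℕ) [Fact p.Prime], (p : ℤ) ∣ discr K → p ≠ ℓ₀ → ∀ Q : (W.baseChange ℚ_[p]).toAffine.Point, 2 • Q = 0 → Q = 0)
    (h4 : Nat.card (W.selmerGroup 2) = 4)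
    {Wd : WeierstrassCurve ℚ} [Wd.IsElliptic] (Cd : VariableChange ℚ) (hCd : Cd • W.quadraticTwist (discr K : ℚ) = Wd)
    (hSel : Nat.card (Wd.selmerGroup 2) = 2) (v : HeightOneSpectrum (𝓞 ℚ)) (hv : (ℓ₀ : 𝓞 ℚ) ∈ v.asIdeal) :
    ∀ c ∈ (Wd.kummerSelmerStructure ((2 : ℕ) : ℤ)).selmerGroup,
      galoisCohomology.localization (Wd.torsionGaloisModule ((2 : ℕ) : ℤ)) (Sum.inr v) 1 c = 0 := by
  haveI : Fact ℓ₀.Prime := ⟨hℓ⟩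
  have hs := twin_le_strictLocalKer_of_natCard_selmerGroup_eq_four W hΔ hK hodd hH h2K hℓd hq2 hT h4 Cd hCd hSel
  have hvℓ : ((primesEquiv v : Nat.Primes) : ℕ) = ℓ₀ := primesEquiv_eq_of_natCast_mem hℓ hv
  apply forall_selmer_localization_eq_zero_of_le_strictLocalKer Wd v
  subst hvℓ
  exact hs

end Summit.BirchSwinnertonDyer.BirchSwinnertonDyer.Theorems.GenusSupplyNarrow.TwinStrict

end
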